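import Literature.Analysis.FluidPDE.ForwardDSSLocalLeray
import HarnessLib

/-!
# The time-periodic Leray system of Bradshaw–Tsai 2017 ([BT1] §2) and the decomposition of
  `bradshawTsai2017_thm_2_4` into its three printed ingredients

Analysis/FluidPDE fact file under the named fact
`Literature.Analysis.FluidPDE.bradshawTsai2017_thm_2_4` (`ForwardDSSLocalLeray.lean`), which
renders "Theorem 2.4 **with** Lemma 3.4 **and** §4 ¶1–3" of Bradshaw–Tsai, Ann. Henri Poincaré 18
(2017) = arXiv:1510.07504 [BT1] in the physical variables: every divergence free `λ`-DSS
`v₀ ∈ L³_w(ℝ³)` admits an ansatz pair `BradshawTsai2017.IsAnsatzSolution λ v₀ v π`. That fact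
merges three results of different nature, printed in the *similarity variables*
`y = x/√(2t)`, `s = log √(2t)` ([BT1] (1.7)):

1. **Lemma 3.4** (linear, heat equation): for such `v₀`, the profile
   `U₀(y,s) = √(2t) (e^{tΔ}v₀)(x)` satisfies **Assumption 2.1** with `T = log λ`, any `q ∈ (3,∞]`;
2. **Theorem 2.4** (the PDE core: Galerkin approximation of the mollified perturbed Leray
   system, Brouwer's fixed point theorem for the period map, limits `k → ∞`, `ε → 0`, pressure by
   Riesz transforms, suitability "as in [CKN]"): under Assumption 2.1 with `q = 10/3` the
   time-periodic Leray system (2.1) has a suitable periodic weak solution `(u, p)`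
   (Definitions 2.2–2.3) with period `T`, and (proof, p. 10) `p ∈ L^{5/3}(ℝ³ × [0,T])`;
3. **§4 ¶1–3 and its last paragraph** (calculus): `v(x,t) = u(y,s)/√(2t)`,
   `π(x,t) = p(y,s)/(2t)` is then an ansatz pair — "(v,π) is a distributional solution to (NSE)
   … `v − e^{tΔ}v₀ ∈ L^∞(1,λ²;L²(ℝ³)) ∩ L²(1,λ²;H¹(ℝ³))` … Local energy inequality: This
   property for (v,π) is inherited from the suitability of (u,p) in the self-similar variables".

This file vendors the similarity-variable notions of [BT1] §2 as real definitions, states 1–3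
as three named facts with the source's numbering, and **proves the assembly**
`bradshawTsai2017_thm_2_4_of_parts : lemma_3_4 → thm_2_4_periodic → ansatz_transport →
bradshawTsai2017_thm_2_4`, so that the trust base of [BT1] Thm 2.4 in the tree splits into the
PDE construction proper (2) and two independently dischargeable pieces (1: heat-semigroup
estimates on `L³_w`-DSS data via Lemmas 3.1–3.2; 3: a change of variables).

## Contents

* `frobeniusInner A B = ∑ᵢ ⟪A eᵢ, B eᵢ⟫`: the pairing `(∇u, ∇f)` of [BT1] (2.2), companion of the
  accepted `frobeniusNormSq` (`frobeniusInner_self`).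
* `BradshawTsai2017.similarityProfile v₀ s y = eˢ (e^{tΔ}v₀)(eˢ y)`, `t = e^{2s}/2`: the profile
  `U₀` of Lemma 3.4, (3.13) (`√(2t) = eˢ`, `x = eˢ y`); `physVelocity u`, `physPressure p`: the
  ansatz (1.6)–(1.7) `v(x,t) = u(y,s)/√(2t)`, `π(x,t) = p(y,s)/(2t)` (extended by `0` to `t ≤ 0`).
* `BradshawTsai2017.ProfileAssumption T q U₀`: **Assumption 2.1**.
* `BradshawTsai2017.IsPeriodicDivFreeTest T f`: the test class `𝒟_T` (§1, Notation).
* `BradshawTsai2017.IsSuitablePeriodicWeakSolution T U₀ u p`: **Definitions 2.2 and 2.3**.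
* Facts `bradshawTsai2017_lemma_3_4`, `bradshawTsai2017_thm_2_4_periodic`,
  `bradshawTsai2017_ansatz_transport`; proved: `bradshawTsai2017_thm_2_4_of_parts`, the
  consistency of the change of variables (`physVelocity_similarityProfile`:
  `U₀ ↦ e^{tΔ}v₀`), the `λ`-DSS property of the physical image of `T`-periodic fields
  (`isDiscretelySelfSimilar_physVelocity`, `nsRescalePressure_physPressure`), the
  `T`-periodicity of `U₀` for `λ`-DSS data (`similarityProfile_add_log`), and non-vacuity of the
  two structures.

## Design notes

* *Assumption 2.1.* `U₀` is `C¹` jointly ("continuously differentiable in `y` and `s`"); the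
  equation `LU₀ = ∂ₛU₀ − ΔU₀ − U₀ − y·∇U₀ = 0` is rendered, as [BT1] (2.3) defines `⟨LW, ζ⟩` for
  `C¹` fields, in the form `(∂ₛU₀ − U₀ − y·∇U₀, ζ) + (∇U₀, ∇ζ) = 0` for every `s` and every
  `ζ ∈ C_c^∞(ℝ³;ℝ³)` ([BT1] allow `ζ ∈ C¹₀`; equivalent by density). The clause
  `∂ₛU₀ ∈ L^∞(0,T;L^{6/5}_loc)` is omitted: "membership in `C¹` guarantees that
  `∂ₛU₀ ∈ L^∞(0,T;L^{6/5}_loc(ℝ³))` and we only mention this inclusion explicitly since later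
  estimates will depend on [it]" (loc. cit.). `L^∞(0,T;L⁴ ∩ L^q)` is `sup_s ‖U₀(s)‖ < ∞` (for a
  continuous periodic field the essential supremum over a period is the supremum). The decay
  modulus `Θ` is `ℝ≥0∞`-valued with `Θ(R) → 0` (only its tail matters; `min(Θ, sup_s ‖U₀‖_q)` is
  a finite modulus).
* *Definitions 2.2–2.3.* One weak spatial gradient `G = ∇u` on `ℝ × ℝ³` (the tree's
  `HasWeakSpatialGradientOn ⊤`) serves the class `u − U₀ ∈ L²(0,T;H¹)` (as
  `∫₀ᵀ∫ |G − DU₀|² < ∞`; the `L²` part is implied by the `L^∞(0,T;L²)` bound), the weak form (2.2)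
  against `𝒟_T` (with `(∇u,∇f) = ∫ frobeniusInner G Df`, `y·∇u = G y`, `u·∇u = G u`), and the
  local energy inequality (2.4), written as printed with `½|u|²` on the left. "`(u,p)` solves (2.1)
  in the sense of distributions" is the identity against all `ψ ∈ C_c^∞(ℝ⁴;ℝ³)` with every
  derivative on `ψ` — `∫∫ ⟪u, ∂ₛψ + Δψ − 2ψ − (y·∇)ψ + (u·∇)ψ⟫ + p div ψ = 0` (from
  `(y·∇u, ψ) = −(u, 3ψ + (y·∇)ψ)` and `(u·∇u, ψ) = −(u, (u·∇)ψ)` for `div u = 0`; cf. §4: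
  "`∂ₜζ = (2t)⁻²(∂ₛ − 2 − y·∇_y)f`") — the shape of the tree's `IsDistributionalNSSolutionOn`, and
  "`∇·u = 0`" is weak divergence-freeness of a.e. slice. The `L^∞(0,T;L²)` bound on `u − U₀` is
  stated for **every** `s` (the constructed `U = u − U₀` is the weak `L²`-limit "for all
  `s ∈ [0,T]`", proof of Thm 2.4, and Thm 1.2's `t^{1/4}`-estimate is printed "for any
  `t ∈ (0,∞)`"), exactly as `IsAnsatzSolution.energy_sub_heat` (see `ForwardDSSLocalLeray`,
  "Everywhere in `t`"). The boundary condition at spatial infinity in (2.1) is implied by this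
  bound and is not a separate field. `p ∈ L^{3/2}_loc(ℝ⁴)` carries local integrability of `p`
  (measurability). The class `p ∈ L^{5/3}(ℝ³ × [0,T])` belongs to the *proof* of Thm 2.4 and is a
  separate conjunct of `bradshawTsai2017_thm_2_4_periodic` (it is what
  `IsAnsatzSolution.pressure_five_thirds` consumes).
* *The transport fact* carries Assumption 2.1 for `U₀ = similarityProfile v₀` among its
  hypotheses, as §4 does ("By Lemma 3.4, `U₀` … satisfies Assumption 2.1. Let `(u,p)` be the
  time-periodic weak solution described in Theorem 2.4"); no hypothesis on `v₀` itself is used by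
  the change of variables (`physVelocity (similarityProfile v₀) = e^{tΔ}v₀` on `t > 0` holds by
  definition, `physVelocity_similarityProfile`). Its discharge is a change of variables under the
  diffeomorphism `(s,y) ↦ (e^{2s}/2, eˢy)` of `ℝ × ℝ³` onto `(0,∞) × ℝ³` (Jacobian `e^{5s}`), for
  which the tree so far has only the affine toolkit `SpaceTimeRescaling`.
* Not here: Lemmas 2.5–2.6 and the `ε`-approximants of the proof of Thm 2.4 (also the content of
  `bradshawTsai2019_prop_3_1_approximation`), Lemmas 3.1–3.2; they are the next layer down.

## Mathlib / tree search

Mathlib (this pin) has no Navier–Stokes / Leray-system notions. Reused from the tree (nothing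
redefined): `IsAnsatzSolution`, `bradshawTsai2017_thm_2_4`, `heatExtension_dss`
(`ForwardDSSLocalLeray`); `HasWeakSpatialGradientOn`, `frobeniusNormSq`, `IsSpaceTimeTestOn`,
`timeDeriv`, `convect`, `VectorCalculus.divergence/IsDivFree`, `IsWeaklyDivFree`
(`SuitableWeak`, `WeakSolution`, `VectorCalculus`); `IsTestFunctionOn` (`FunctionSpaces/SobolevDomain`);
`IsDiscretelySelfSimilar`, `nsRescale*` (`SelfSimilar`); `MemWeakLp` (`FunctionSpaces/WeakLp`);
`UnboundedOperators.heatExtension` (`UnboundedOperators/HeatKernel`). `lean search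
'PeriodicLeray|ProfileAssumption|frobeniusInner|similarity'`: no prior rendering of [BT1] §2.

## References

* Z. Bradshaw, T.-P. Tsai, *Forward discretely self-similar solutions of the Navier–Stokes
  equations II*, Ann. Henri Poincaré 18 (2017) 1095–1119 = arXiv:1510.07504: §1 ((1.6)–(1.7),
  Notation `𝒟_T`), §2 ((2.1), Assumption 2.1, (2.3), Def. 2.2 with (2.2), Def. 2.3 with (2.4),
  Thm 2.4 and its proof, p. 10: "`p ∈ L^{5/3}(ℝ³ × [0,T])`"), Lemma 3.4 with (3.13), §4 (proof of
  Thm 1.2) [BradshawTsai2017AHP].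
* L. Caffarelli, R. Kohn, L. Nirenberg, CPAM 35 (1982), §2 [CaffarelliKohnNirenberg1982].
-/

noncomputable section

open MeasureTheory Set Function Filter Topology TopologicalSpace Metric Module
open scoped NNReal ENNReal InnerProductSpace RealInnerProductSpace Laplacian

namespace Literature.Analysis.FluidPDE

/-- Local notation for physical space `ℝ³ = EuclideanSpace ℝ (Fin 3)`. -/
local notation "ℝ³" => EuclideanSpace ℝ (Fin 3)

section Frobenius

variable {E : Type*} [NormedAddCommGroup E] [InnerProductSpace ℝ E] [FiniteDimensional ℝ E]
variable {F : Type*} [NormedAddCommGroup F] [InnerProductSpace ℝ F]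

/-- The **Frobenius pairing** `A : B = ∑ᵢ ⟪A eᵢ, B eᵢ⟫` of two linear maps over the standard
orthonormal frame `(eᵢ)` of `E` — the integrand of `(∇u, ∇f) = ∫ ∇u : ∇f` in [BT1] (2.2)–(2.3);
companion of the accepted `frobeniusNormSq L = ∑ᵢ ‖L eᵢ‖²`. [folklore] -/
def frobeniusInner (A B : E →L[ℝ] F) : ℝ :=
  ∑ i, ⟪A (stdOrthonormalBasis ℝ E i), B (stdOrthonormalBasis ℝ E i)⟫

/-- `A : A = |A|²` (the accepted `frobeniusNormSq`). [folklore] -/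
theorem frobeniusInner_self (A : E →L[ℝ] F) : frobeniusInner A A = frobeniusNormSq A := by
  simp only [frobeniusInner, frobeniusNormSq, real_inner_self_eq_norm_sq]

/-- The Frobenius pairing is symmetric. [folklore] -/
theorem frobeniusInner_comm (A B : E →L[ℝ] F) : frobeniusInner A B = frobeniusInner B A := by
  simp only [frobeniusInner, real_inner_comm]

/-- The Frobenius pairing with `0` on the left vanishes. [folklore] -/
@[simp]
theorem frobeniusInner_zero_left (B : E →L[ℝ] F) : frobeniusInner 0 B = 0 := by
  simp [frobeniusInner]

/-- The Frobenius pairing with `0` on the right vanishes. [folklore] -/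
@[simp]
theorem frobeniusInner_zero_right (A : E →L[ℝ] F) : frobeniusInner A 0 = 0 := by
  simp [frobeniusInner]

end Frobenius

namespace BradshawTsai2017

/-! ## The similarity variables `y = x/√(2t)`, `s = log √(2t)` -/

/-- **The profile of a datum** ([BT1] Lemma 3.4, (3.13)): `U₀(y,s) = √(2t) (e^{tΔ}v₀)(x)` in the
similarity variables `y = x/√(2t)`, `s = log √(2t)` of (1.7), i.e. with `√(2t) = eˢ`,
`t = e^{2s}/2`, `x = eˢ y`: `similarityProfile v₀ s y = eˢ (e^{tΔ}v₀)(eˢ y)`, the caloric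
extension being the tree's `UnboundedOperators.heatExtension v₀ t = heatKernel t ⋆ v₀`. [cite: BradshawTsai2017AHP, Lemma 3.4 (3.13)] -/
def similarityProfile (v₀ : ℝ³ → ℝ³) (s : ℝ) (y : ℝ³) : ℝ³ :=
  Real.exp s • UnboundedOperators.heatExtension v₀ (Real.exp (2 * s) / 2) (Real.exp s • y)

/-- **The ansatz (1.6)–(1.7), velocity**: the physical field `v(x,t) = u(y,s)/√(2t)`,
`y = x/√(2t)`, `s = log √(2t)`, of a profile `u : ℝ → ℝ³ → ℝ³` (time `s` first), for `t > 0`;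
extended by the junk value `0` to `t ≤ 0` (no clause of the tree's solution notions on the slab
`t > 0` sees `t ≤ 0`, and `0` keeps the field `λ`-DSS on all of `ℝ × ℝ³`). [cite: BradshawTsai2017AHP, (1.6)–(1.7)] -/
def physVelocity (u : ℝ → ℝ³ → ℝ³) (t : ℝ) (x : ℝ³) : ℝ³ :=
  if 0 < t then
    (Real.sqrt (2 * t))⁻¹ • u (Real.log (Real.sqrt (2 * t))) ((Real.sqrt (2 * t))⁻¹ • x)
  else 0

/-- **The ansatz, pressure** ([BT1] §4: "`π(x,t) = p(y,s)/2t`"), for `t > 0`; junk value `0`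
for `t ≤ 0`. [cite: BradshawTsai2017AHP, §4 (proof of Thm 1.2)] -/
def physPressure (p : ℝ → ℝ³ → ℝ) (t : ℝ) (x : ℝ³) : ℝ :=
  if 0 < t then (2 * t)⁻¹ * p (Real.log (Real.sqrt (2 * t))) ((Real.sqrt (2 * t))⁻¹ • x)
  else 0

/-- `e^{log √(2t)} = √(2t)` for `t > 0`. [folklore] -/
theorem exp_log_sqrt_two_mul {t : ℝ} (ht : 0 < t) :
    Real.exp (Real.log (Real.sqrt (2 * t))) = Real.sqrt (2 * t) :=
  Real.exp_log (Real.sqrt_pos.2 (by linarith))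

/-- `e^{2 log √(2t)}/2 = t` for `t > 0` (the inverse of `s = log √(2t)` is `t = e^{2s}/2`). [folklore] -/
theorem exp_two_mul_log_sqrt_div_two {t : ℝ} (ht : 0 < t) :
    Real.exp (2 * Real.log (Real.sqrt (2 * t))) / 2 = t := by
  rw [two_mul, Real.exp_add, exp_log_sqrt_two_mul ht, Real.mul_self_sqrt (by linarith)]
  ring

/-- **Consistency of the change of variables**: the physical image of the profile
`U₀ = √(2t) e^{tΔ}v₀` is the caloric extension itself, `physVelocity (similarityProfile v₀) t =
e^{tΔ}v₀` for `t > 0` ([BT1] §4: `v − e^{tΔ}v₀ = (u − U₀)(y,s)/√(2t)`). [cite: BradshawTsai2017AHP, §4 (proof of Thm 1.2)] -/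
theorem physVelocity_similarityProfile (v₀ : ℝ³ → ℝ³) {t : ℝ} (ht : 0 < t) (x : ℝ³) :
    physVelocity (similarityProfile v₀) t x = UnboundedOperators.heatExtension v₀ t x := by
  have hsq : 0 < Real.sqrt (2 * t) := Real.sqrt_pos.2 (by linarith)
  simp only [physVelocity, if_pos ht, similarityProfile, exp_log_sqrt_two_mul ht,
    exp_two_mul_log_sqrt_div_two ht, smul_smul, mul_inv_cancel₀ hsq.ne', one_smul,
    inv_mul_cancel₀ hsq.ne']

/-- The physical velocity minus the caloric extension is the rescaled difference of profiles:
`v(t,x) − e^{tΔ}v₀(x) = (u − U₀)(s,y)/√(2t)` for `t > 0` ([BT1] §4). [cite: BradshawTsai2017AHP, §4 (proof of Thm 1.2)] -/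
theorem physVelocity_sub_heatExtension (u : ℝ → ℝ³ → ℝ³) (v₀ : ℝ³ → ℝ³) {t : ℝ} (ht : 0 < t)
    (x : ℝ³) :
    physVelocity u t x - UnboundedOperators.heatExtension v₀ t x =
      (Real.sqrt (2 * t))⁻¹ •
        (u (Real.log (Real.sqrt (2 * t))) ((Real.sqrt (2 * t))⁻¹ • x) -
          similarityProfile v₀ (Real.log (Real.sqrt (2 * t))) ((Real.sqrt (2 * t))⁻¹ • x)) := by
  rw [← physVelocity_similarityProfile v₀ ht x, smul_sub]
  simp only [physVelocity, if_pos ht]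

/-- **`T`-periodic profiles have `λ`-DSS physical images** (`T = log λ`; [BT1] §1: "`λ`-DSS
solutions are decided by their behavior on the time interval `1 ≤ t ≤ λ²` … where `u` is
time-periodic with period `log λ`"): if `u(s + log λ) = u(s)` then `λ v(λ²t, λx) = v(t,x)` on
`ℝ × ℝ³` for `v = physVelocity u`. [cite: BradshawTsai2017AHP, §1 (1.6)–(1.7)] -/
theorem isDiscretelySelfSimilar_physVelocity {c : ℝ} (hc : 0 < c) {u : ℝ → ℝ³ → ℝ³}
    (hu : ∀ s y, u (s + Real.log c) y = u s y) :
    FluidPDE.IsDiscretelySelfSimilar c (physVelocity u) := by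
  funext t x
  rw [FluidPDE.nsRescale_apply]
  by_cases ht : 0 < t
  · have ht' : 0 < c ^ 2 * t := mul_pos (pow_pos hc 2) ht
    have hsq : 0 < Real.sqrt (2 * t) := Real.sqrt_pos.2 (by linarith)
    have hsqrt : Real.sqrt (2 * (c ^ 2 * t)) = c * Real.sqrt (2 * t) := by
      rw [show 2 * (c ^ 2 * t) = c ^ 2 * (2 * t) by ring, Real.sqrt_mul (sq_nonneg c),
        Real.sqrt_sq hc.le]
    have hlog : Real.log (c * Real.sqrt (2 * t)) = Real.log (Real.sqrt (2 * t)) + Real.log c := by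
      rw [Real.log_mul hc.ne' hsq.ne', add_comm]
    simp only [physVelocity, if_pos ht, if_pos ht', hsqrt, hlog, hu, smul_smul, mul_inv_rev,
      inv_mul_cancel_right₀ hc.ne']
    congr 1
    field_simp
  · have ht' : ¬ 0 < c ^ 2 * t := fun h => ht (pos_of_mul_pos_right h (sq_nonneg c))
    simp only [physVelocity, if_neg ht, if_neg ht', smul_zero]

/-- The pressure counterpart: if `p(s + log λ) = p(s)` then `λ² π(λ²t, λx) = π(t,x)` for
`π = physPressure p` ([BT1] §1, (1.3)). [cite: BradshawTsai2017AHP, §1 (1.3)] -/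
theorem nsRescalePressure_physPressure {c : ℝ} (hc : 0 < c) {p : ℝ → ℝ³ → ℝ}
    (hp : ∀ s y, p (s + Real.log c) y = p s y) :
    FluidPDE.nsRescalePressure c (physPressure p) = physPressure p := by
  funext t x
  rw [FluidPDE.nsRescalePressure_apply]
  by_cases ht : 0 < t
  · have ht' : 0 < c ^ 2 * t := mul_pos (pow_pos hc 2) ht
    have hsq : 0 < Real.sqrt (2 * t) := Real.sqrt_pos.2 (by linarith)
    have hsqrt : Real.sqrt (2 * (c ^ 2 * t)) = c * Real.sqrt (2 * t) := by
      rw [show 2 * (c ^ 2 * t) = c ^ 2 * (2 * t) by ring, Real.sqrt_mul (sq_nonneg c),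
        Real.sqrt_sq hc.le]
    have hlog : Real.log (c * Real.sqrt (2 * t)) = Real.log (Real.sqrt (2 * t)) + Real.log c := by
      rw [Real.log_mul hc.ne' hsq.ne', add_comm]
    simp only [physPressure, if_pos ht, if_pos ht', hsqrt, hlog, hp, smul_smul, mul_inv_rev,
      inv_mul_cancel_right₀ hc.ne']
    field_simp
  · have ht' : ¬ 0 < c ^ 2 * t := fun h => ht (pos_of_mul_pos_right h (sq_nonneg c))
    simp only [physPressure, if_neg ht, if_neg ht', mul_zero]

/-- **The profile of a `λ`-DSS datum is `T`-periodic, `T = log λ`** ([BT1], proof of Lemma 3.4: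
"`e^{tΔ}v₀` is the … `λ`-DSS solution to the heat equation … it follows that `U₀` is …
`T`-periodic for `T = log λ`"), from the accepted DSS covariance of the caloric extension
`heatExtension_dss`. [cite: BradshawTsai2017AHP, proof of Lemma 3.4] -/
theorem similarityProfile_add_log {c : ℝ} (hc : 0 < c) {v₀ : ℝ³ → ℝ³}
    (hv₀ : FluidPDE.nsRescaleData c v₀ = v₀) (s : ℝ) (y : ℝ³) :
    similarityProfile v₀ (s + Real.log c) y = similarityProfile v₀ s y := by
  have ht : 0 < Real.exp (2 * s) / 2 := by positivity
  simp only [similarityProfile]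
  rw [show 2 * (s + Real.log c) = 2 * s + 2 * Real.log c by ring, Real.exp_add, Real.exp_add,
    Real.exp_log hc, show (2 : ℝ) * Real.log c = Real.log (c ^ 2) by
      rw [Real.log_pow]; norm_num, Real.exp_log (pow_pos hc 2),
    show Real.exp (2 * s) * c ^ 2 / 2 = c ^ 2 * (Real.exp (2 * s) / 2) by ring, mul_smul,
    mul_comm (Real.exp s) c, mul_smul, heatExtension_dss hc hv₀ ht]

/-! ## Assumption 2.1 and the test class `𝒟_T` -/

/-- **[BT1] Assumption 2.1** on a profile `U₀ : ℝ × ℝ³ → ℝ³` (time `s` first) with period `T`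
and integrability exponent `q`: "`U₀(y,s)` is continuously differentiable in `y` and `s`,
periodic in `s` with period `T > 0`, divergence free, and satisfies
`∂ₛU₀ − ΔU₀ − U₀ − y·∇U₀ = 0`, `U₀ ∈ L^∞(0,T;L⁴ ∩ L^q(ℝ³))`,
`∂ₛU₀ ∈ L^∞(0,T;L^{6/5}_loc(ℝ³))`, and `sup_{s∈[0,T]} ‖U₀‖_{L^q(ℝ³∖B_R)} ≤ Θ(R)` for some
`q ∈ (3,∞]` and `Θ : [0,∞) → [0,∞)` such that `Θ(R) → 0` as `R → ∞`." The equation `LU₀ = 0` is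
in the form (2.3), `⟨LW,ζ⟩ = (∂ₛW − W − y·∇W, ζ) + (∇W, ∇ζ)`, against `ζ ∈ C_c^∞(ℝ³;ℝ³)` at every
`s`; the `L^{6/5}_loc` clause is automatic for `C¹` periodic fields and omitted (see the module
docstring); `q` and `T` are parameters (`T > 0` is imposed where the structure is used). [cite: BradshawTsai2017AHP, Assumption 2.1] -/
structure ProfileAssumption (T : ℝ) (q : ℝ≥0∞) (U₀ : ℝ → ℝ³ → ℝ³) : Prop where
  /-- `U₀` is continuously differentiable in `(s, y)`. -/
  contDiff : ContDiff ℝ 1 (uncurry U₀)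
  /-- `U₀` is `T`-periodic in `s`. -/
  periodic : ∀ s y, U₀ (s + T) y = U₀ s y
  /-- `U₀(s)` is (classically) divergence free for every `s`. -/
  divFree : ∀ s, VectorCalculus.IsDivFree (U₀ s)
  /-- `LU₀ = 0` in the form (2.3): `(∂ₛU₀ − U₀ − y·∇U₀, ζ) + (∇U₀, ∇ζ) = 0`, `ζ ∈ C_c^∞(ℝ³;ℝ³)`. -/
  leray : ∀ s, ∀ ζ : ℝ³ → ℝ³, FunctionSpaces.IsTestFunctionOn (⊤ : Opens ℝ³) ζ →
    ∫ y, (⟪timeDeriv U₀ s y - U₀ s y - fderiv ℝ (U₀ s) y y, ζ y⟫ +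
      frobeniusInner (fderiv ℝ (U₀ s) y) (fderiv ℝ ζ y)) = 0
  /-- `U₀ ∈ L^∞(0,T;L⁴(ℝ³))`: `sup_s ‖U₀(s)‖_{L⁴} < ∞`. -/
  memL4 : ⨆ s, eLpNorm (U₀ s) 4 volume < ∞
  /-- `U₀ ∈ L^∞(0,T;L^q(ℝ³))`: `sup_s ‖U₀(s)‖_{L^q} < ∞`. -/
  memLq : ⨆ s, eLpNorm (U₀ s) q volume < ∞
  /-- Uniform decay: `sup_s ‖U₀(s)‖_{L^q(ℝ³ ∖ B_R)} ≤ Θ(R)` with `Θ(R) → 0` as `R → ∞`. -/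
  decay : ∃ Θ : ℝ → ℝ≥0∞, Tendsto Θ atTop (𝓝 0) ∧
    ∀ s R, eLpNorm (U₀ s) q (volume.restrict (ball (0 : ℝ³) R)ᶜ) ≤ Θ R

/-- **Non-vacuity**: the zero profile satisfies Assumption 2.1 for every `T`, `q`. [folklore] -/
theorem profileAssumption_zero (T : ℝ) (q : ℝ≥0∞) : ProfileAssumption T q (0 : ℝ → ℝ³ → ℝ³) where
  contDiff := by rw [uncurry_zero]; exact contDiff_const
  periodic s y := rfl
  divFree s y := by simp [VectorCalculus.divergence]
  leray s ζ _ := by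
    have h0 : ((0 : ℝ → ℝ³ → ℝ³) s) = (0 : ℝ³ → ℝ³) := rfl
    simp only [Pi.zero_apply, timeDeriv_apply, deriv_const', sub_self, h0, fderiv_zero,
      zero_apply, inner_zero_left, frobeniusInner_zero_left, add_zero, integral_zero]
  memL4 := by simp
  memLq := by simp
  decay := ⟨0, tendsto_const_nhds, fun s R => by simp⟩

/-- **The test class `𝒟_T`** ([BT1] §1, Notation): "the collection of all smooth divergence free
vector fields in `ℝ³ × ℝ` which are time periodic with period `T` and whose supports are compact
in space" (`f : ℝ → ℝ³ → ℝ³`, time first; compact support in space uniformly in `s`). [cite: BradshawTsai2017AHP, §1 Notation] -/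
structure IsPeriodicDivFreeTest (T : ℝ) (f : ℝ → ℝ³ → ℝ³) : Prop where
  /-- `f` is smooth on `ℝ × ℝ³`. -/
  contDiff : ContDiff ℝ (⊤ : ℕ∞) (uncurry f)
  /-- `f` is `T`-periodic in `s`. -/
  periodic : ∀ s y, f (s + T) y = f s y
  /-- `f(s)` is divergence free for every `s`. -/
  divFree : ∀ s, VectorCalculus.IsDivFree (f s)
  /-- The supports of the `f(s)` lie in a fixed ball. -/
  compact_support : ∃ R : ℝ, ∀ s y, R ≤ ‖y‖ → f s y = 0

/-- The zero field belongs to `𝒟_T`. [folklore] -/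
theorem isPeriodicDivFreeTest_zero (T : ℝ) : IsPeriodicDivFreeTest T (0 : ℝ → ℝ³ → ℝ³) where
  contDiff := by rw [uncurry_zero]; exact contDiff_const
  periodic s y := rfl
  divFree s y := by simp [VectorCalculus.divergence]
  compact_support := ⟨0, fun s y _ => rfl⟩

/-! ## Definitions 2.2–2.3: suitable periodic weak solutions of the Leray system (2.1) -/

/-- **[BT1] Definitions 2.2 and 2.3: suitable periodic weak solutions** `(u, p)` of the
time-periodic Leray system (2.1)
`∂ₛu − Δu = u + y·∇u − ∇p − u·∇u`, `∇·u = 0` in `ℝ³ × ℝ`, `u(·,s) = u(·,s+T)`,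
`lim_{|y₀|→∞} ∫_{B₁(y₀)} |u − U₀|² = 0`, with profile `U₀` (time `s` first throughout).
*Def. 2.2* ("periodic weak solution"): `u` is divergence free,
`U := u − U₀ ∈ L^∞(0,T;L²(ℝ³)) ∩ L²(0,T;H¹(ℝ³))`, and (2.2)
`∫₀ᵀ ((u,∂ₛf) − (∇u,∇f) + (u + y·∇u − u·∇u, f)) ds = 0` for all `f ∈ 𝒟_T`. *Def. 2.3*: both
`u, p` are `T`-periodic, `u` is a periodic weak solution, `p ∈ L^{3/2}_loc(ℝ⁴)`, `(u,p)` solves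
(2.1) in the sense of distributions, and the local energy inequality (2.4) holds:
`∫∫ (½|u|² + |∇u|²)ψ ≤ ∫∫ ½|u|²(∂ₛψ + Δψ) + ∫∫ (½|u|²((u − y)·∇ψ) + p(u·∇ψ))` for all
nonnegative `ψ ∈ C_c^∞(ℝ⁴)`. Rendering (module docstring, *Definitions 2.2–2.3*): one weak spatial
gradient `G = ∇u` on `ℝ × ℝ³` serves the `H¹` class (`∫₀ᵀ∫|G − DU₀|² < ∞`), (2.2) and (2.4); the
`L^∞(0,T;L²)` bound holds for every `s`; the distributional form of (2.1) has all derivatives on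
the test field. [cite: BradshawTsai2017AHP, Def. 2.2–2.3] -/
structure IsSuitablePeriodicWeakSolution (T : ℝ) (U₀ u : ℝ → ℝ³ → ℝ³) (p : ℝ → ℝ³ → ℝ) :
    Prop where
  /-- `u` is `T`-periodic in `s`. -/
  periodic : ∀ s y, u (s + T) y = u s y
  /-- `p` is `T`-periodic in `s`. -/
  periodic_pressure : ∀ s y, p (s + T) y = p s y
  /-- `∇·u = 0`: almost every slice `u(s)` is weakly divergence free. -/
  divFree : ∀ᵐ s : ℝ, FluidPDE.IsWeaklyDivFree (u s)
  /-- `u − U₀ ∈ L^∞(0,T;L²(ℝ³))`, the bound holding for every `s`. -/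
  energy : ∃ C : ℝ≥0, ∀ s : ℝ, ∫⁻ y, ‖u s y - U₀ s y‖ₑ ^ 2 ≤ C
  /-- `p` is locally integrable on `ℝ⁴`. -/
  locallyIntegrable_pressure : LocallyIntegrable (uncurry p) volume
  /-- `p ∈ L^{3/2}_loc(ℝ⁴)`. -/
  pressure_threeHalves : ∀ K : Set (ℝ × ℝ³), IsCompact K →
    ∫⁻ z in K, ‖p z.1 z.2‖ₑ ^ (3 / 2 : ℝ) < ∞
  /-- `(u, p)` solves the first line of (2.1) in the sense of distributions on `ℝ × ℝ³`:
  `∫∫ ⟪u, ∂ₛψ + Δψ − 2ψ − (y·∇)ψ + (u·∇)ψ⟫ + p div ψ = 0` for all `ψ ∈ C_c^∞(ℝ⁴;ℝ³)`. -/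
  distributional : ∀ ψ : ℝ → ℝ³ → ℝ³, FluidPDE.IsSpaceTimeTestOn (⊤ : Opens (ℝ × ℝ³)) ψ →
    ∫ z : ℝ × ℝ³, (⟪u z.1 z.2, timeDeriv ψ z.1 z.2⟫ + ⟪u z.1 z.2, Δ (ψ z.1) z.2⟫ -
      ⟪u z.1 z.2, (2 : ℝ) • ψ z.1 z.2 + fderiv ℝ (ψ z.1) z.2 z.2⟫ +
      ⟪u z.1 z.2, convect (u z.1) (ψ z.1) z.2⟫ +
      p z.1 z.2 * VectorCalculus.divergence (ψ z.1) z.2) = 0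
  /-- Bundled under one weak spatial gradient `G = ∇u` on `ℝ × ℝ³`: (i) `G` is a weak spatial
  gradient of `u`; (ii) `u − U₀ ∈ L²(0,T;H¹(ℝ³))` (gradient part); (iii) the weak form (2.2)
  against `𝒟_T`; (iv) the local energy inequality (2.4) for nonnegative `ψ ∈ C_c^∞(ℝ⁴)`. -/
  weakForm : ∃ G : ℝ → ℝ³ → ℝ³ →L[ℝ] ℝ³,
    FluidPDE.HasWeakSpatialGradientOn (⊤ : Opens (ℝ × ℝ³)) u G ∧
    (∫⁻ z in Ioo 0 T ×ˢ (univ : Set ℝ³),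
      ENNReal.ofReal (frobeniusNormSq (G z.1 z.2 - fderiv ℝ (U₀ z.1) z.2)) < ∞) ∧
    (∀ f : ℝ → ℝ³ → ℝ³, IsPeriodicDivFreeTest T f →
      ∫ s in Ioo 0 T, ∫ y, (⟪u s y, timeDeriv f s y⟫ - frobeniusInner (G s y) (fderiv ℝ (f s) y) +
        ⟪u s y + G s y y - G s y (u s y), f s y⟫) = 0) ∧
    (∀ ψ : ℝ → ℝ³ → ℝ, FluidPDE.IsSpaceTimeTestOn (⊤ : Opens (ℝ × ℝ³)) ψ → (∀ s y, 0 ≤ ψ s y) →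
      ∫ s, ∫ y, (‖u s y‖ ^ 2 / 2 + frobeniusNormSq (G s y)) * ψ s y ≤
        ∫ s, ∫ y, (‖u s y‖ ^ 2 / 2 * (timeDeriv ψ s y + Δ (ψ s) y) +
          (‖u s y‖ ^ 2 / 2 * ⟪u s y - y, gradient (ψ s) y⟫ + p s y * ⟪u s y, gradient (ψ s) y⟫)))

/-- **Non-vacuity**: for the zero profile the trivial pair `(0, 0)` is a suitable periodic weak
solution (every integrand vanishes). [folklore] -/
theorem isSuitablePeriodicWeakSolution_zero (T : ℝ) :
    IsSuitablePeriodicWeakSolution T (0 : ℝ → ℝ³ → ℝ³) (0 : ℝ → ℝ³ → ℝ³) (0 : ℝ → ℝ³ → ℝ) where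
  periodic s y := rfl
  periodic_pressure s y := rfl
  divFree := Eventually.of_forall fun s θ _ => by simp
  energy := ⟨0, fun s => by simp⟩
  locallyIntegrable_pressure := by
    rw [uncurry_zero]; exact (integrable_zero (ℝ × ℝ³) ℝ volume).locallyIntegrable
  pressure_threeHalves K _ := by
    simp only [Pi.zero_apply, enorm_zero, ENNReal.zero_rpow_of_pos (by norm_num : (0:ℝ) < 3 / 2),
      lintegral_zero]
    exact ENNReal.zero_lt_top
  distributional ψ _ := by simp
  weakForm := by
    refine ⟨0, hasWeakSpatialGradientOn_zero _, ?_, fun f _ => by simp, fun ψ _ _ => by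
      simp [frobeniusNormSq_zero]⟩
    have : (fun z : ℝ × ℝ³ => ENNReal.ofReal (frobeniusNormSq
        ((0 : ℝ → ℝ³ → ℝ³ →L[ℝ] ℝ³) z.1 z.2 - fderiv ℝ ((0 : ℝ → ℝ³ → ℝ³) z.1) z.2))) =
        fun _ => 0 := by
      funext z
      have h0 : ((0 : ℝ → ℝ³ → ℝ³) z.1) = (0 : ℝ³ → ℝ³) := rfl
      rw [h0, fderiv_zero]
      simp [frobeniusNormSq_zero]
    rw [this, lintegral_zero]
    exact ENNReal.zero_lt_top

/-! ## The three printed ingredients of `bradshawTsai2017_thm_2_4` -/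

/-- **[BT1] Lemma 3.4.** "Suppose `v₀` satisfies the assumptions of Theorem 1.2 [divergence free,
`λ`-DSS for some `λ > 1`, `‖v₀‖_{L³_w(ℝ³)} ≤ c₀`] and let `x,t,y,s` satisfy (1.7). Then
`U₀(y,s) = √(2t) (e^{tΔ}v₀)(x)` satisfies Assumption 2.1 with `T = log λ` and any `q ∈ (3,∞]`."
[Proof: `e^{tΔ}v₀` is the divergence free `λ`-DSS solution of the heat equation, whence `U₀` is
divergence free, `T`-periodic, `LU₀ = 0`; `C¹` by heat-kernel smoothing; `L^∞(0,T;L^q)` and the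
decay from Lemma 3.2 (with Lemma 3.1, `L³_w = L³_loc(ℝ³∖{0})` for DSS fields).] [cite: BradshawTsai2017AHP, Lemma 3.4] -/
def _root_.Literature.Analysis.FluidPDE.bradshawTsai2017_lemma_3_4 : Prop :=
  ∀ {c : ℝ}, 1 < c → ∀ {v₀ : ℝ³ → ℝ³}, FunctionSpaces.MemWeakLp v₀ 3 volume →
    FluidPDE.IsWeaklyDivFree v₀ → FluidPDE.nsRescaleData c v₀ = v₀ →
    ∀ {q : ℝ≥0∞}, 3 < q → ProfileAssumption (Real.log c) q (similarityProfile v₀)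

/-- **[BT1] Theorem 2.4 (Existence of suitable periodic weak solutions to (2.1))**, in its own
(similarity) variables: "Assume `U₀(y,s)` satisfies Assumption 2.1 with `q = 10/3`. Then (2.1)
has a periodic suitable weak solution `(u,p)` in `ℝ⁴` with period `T`", together with the class
`p ∈ L^{5/3}(ℝ³ × [0,T])` established in its proof (p. 10: "`‖p_ε‖_{L^{5/3}(ℝ³×[0,T])} ≤
C‖U_ε‖²_{L^{10/3}} + C‖W‖²_{L^{10/3}}` … `p_{ε_k} → p` weakly in `L^{5/3}(ℝ³ × [0,T])`"). [Proof:
Lemma 2.5 (revised profile `W`), Lemma 2.6 (Galerkin approximations of the mollified perturbed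
Leray system (2.7), `T`-periodic by Brouwer's fixed point theorem, uniform bounds (2.9)), limits
`k → ∞` and `ε → 0`, pressure by Riesz transforms and uniqueness for the forced Stokes system,
suitability "as in [CKN]".] [cite: BradshawTsai2017AHP, Thm 2.4 and its proof] -/
def _root_.Literature.Analysis.FluidPDE.bradshawTsai2017_thm_2_4_periodic : Prop :=
  ∀ {T : ℝ}, 0 < T → ∀ {U₀ : ℝ → ℝ³ → ℝ³}, ProfileAssumption T (10 / 3) U₀ →
    ∃ (u : ℝ → ℝ³ → ℝ³) (p : ℝ → ℝ³ → ℝ), IsSuitablePeriodicWeakSolution T U₀ u p ∧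
      ∫⁻ z in Ioo 0 T ×ˢ (univ : Set ℝ³), ‖p z.1 z.2‖ₑ ^ (5 / 3 : ℝ) < ∞

/-- **[BT1] §4, proof of Theorem 1.2, ¶1–3 and last paragraph: the ansatz transports suitable
periodic weak solutions to ansatz pairs.** For `λ > 1`, `T = log λ`, a profile
`U₀ = similarityProfile v₀` satisfying Assumption 2.1 ("By Lemma 3.4"), and a suitable periodic
weak solution `(u,p)` with period `T` and `p ∈ L^{5/3}(ℝ³ × [0,T])` ("described in Theorem 2.4"),
the pair `v(x,t) = u(y,s)/√(2t)`, `π(x,t) = p(y,s)/2t` satisfies: "(v,π) is a distributional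
solution to (NSE). Indeed, if we let `ζ(x,t) = f(y,s)/(2t)` … we recover the weak form of (NSE)";
"`v − e^{tΔ}v₀ ∈ L^∞(1,λ²;L²(ℝ³)) ∩ L²(1,λ²;H¹(ℝ³))`"; "Local energy inequality: This property for
(v,π) is inherited from the suitability of (u,p) … if we let `φ(x,t) = ψ(y,s)/√(2t)` … we recover
the local energy inequality (1.5) for (v,π)"; and `v`, `π` are `λ`-DSS (`T`-periodicity),
`π ∈ L^{5/3}((1,λ²) × ℝ³)` — i.e. `IsAnsatzSolution λ v₀ v π`. A change of variables
(`dx dt = e^{5s} dy ds`); see the module docstring. [cite: BradshawTsai2017AHP, §4 (proof of Thm 1.2) ¶1–3] -/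
def _root_.Literature.Analysis.FluidPDE.bradshawTsai2017_ansatz_transport : Prop :=
  ∀ {c : ℝ}, 1 < c → ∀ {v₀ : ℝ³ → ℝ³} {q : ℝ≥0∞},
    ProfileAssumption (Real.log c) q (similarityProfile v₀) →
    ∀ {u : ℝ → ℝ³ → ℝ³} {p : ℝ → ℝ³ → ℝ},
      IsSuitablePeriodicWeakSolution (Real.log c) (similarityProfile v₀) u p →
      ∫⁻ z in Ioo 0 (Real.log c) ×ˢ (univ : Set ℝ³), ‖p z.1 z.2‖ₑ ^ (5 / 3 : ℝ) < ∞ →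
      IsAnsatzSolution c v₀ (physVelocity u) (physPressure p)

/-- **Assembly: Lemma 3.4 + Theorem 2.4 + §4 ¶1–3 ⟹ `bradshawTsai2017_thm_2_4`** (the physical-
variables rendering of `ForwardDSSLocalLeray`): for an admissible datum, Lemma 3.4 puts its
profile under Assumption 2.1 with `q = 10/3` and `T = log λ > 0`, Theorem 2.4 produces a suitable
periodic weak solution with `p ∈ L^{5/3}(ℝ³ × [0,T])`, and the ansatz transports it to an ansatz
pair. Hence the trust base of `bradshawTsai2017_thm_2_4` is
`{bradshawTsai2017_lemma_3_4, bradshawTsai2017_thm_2_4_periodic, bradshawTsai2017_ansatz_transport}`. [cite: BradshawTsai2017AHP, §4 (proof of Thm 1.2)] -/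
theorem _root_.Literature.Analysis.FluidPDE.bradshawTsai2017_thm_2_4_of_parts
    (h34 : bradshawTsai2017_lemma_3_4) (h24 : bradshawTsai2017_thm_2_4_periodic)
    (h4 : bradshawTsai2017_ansatz_transport) : bradshawTsai2017_thm_2_4 := by
  intro c hc v₀ hw hdiv hdss
  have hA : ProfileAssumption (Real.log c) (10 / 3) (similarityProfile v₀) :=
    h34 hc hw hdiv hdss (by
      rw [show (10 / 3 : ℝ≥0∞) = ((10 / 3 : ℝ≥0) : ℝ≥0∞) by
        rw [ENNReal.coe_div (by norm_num)]; norm_num,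
        show (3 : ℝ≥0∞) = ((3 : ℝ≥0) : ℝ≥0∞) from rfl, ENNReal.coe_lt_coe]
      rw [lt_div_iff₀ (by norm_num)]
      norm_num)
  obtain ⟨u, p, hS, hp⟩ := h24 (Real.log_pos hc) hA
  exact ⟨physVelocity u, physPressure p, h4 hc hA hS hp⟩

end BradshawTsai2017

end Literature.Analysis.FluidPDE

end
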